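import Mathlib
import Literature.RingTheory.CohomologyAnnihilator.Basic
import HarnessLib

/-!
# Supply lemma, syzygy monotonicity of free factorisations, the continuant slope lemma, and the
# «complete annihilator + shallow witnesses» cut

Crux `HomologicalConductor.Persistence` (stmt-ResolutionOfSingularities-16484), chain W4.4b, rung L1,
ideator 2 (technique B); plan-1 ASSIGN v0.6 row «idea-2» (land `slope_lemma` + supply lemma +
`core_of_closed_of_shallow`). Module-theoretic (LinearMap-level) helpers behind the three idea cards of
`L/res-L1-w44b-idea-2/IDEAS.md`; their `Ext`-level counterparts are the tree's
`Literature.RingTheory.CohomologyAnnihilator.StableAnnihilation.smul_ext_eq_zero_of_comp_eq_smul_id` and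
`Theorems.HomologicalConductor.PersistenceSTDCore.smul_ext_eq_zero_of_isSyzygy_one`.

* `exists_comp_eq_smul_id_of_exact` — SUPPLY LEMMA: if `x` kills `N` and `0 → Y → P → N` is exact
  then `x • 𝟙_Y` factors through `P` (`h ∘ f = x • 𝟙`); rank one: `smul_id_factors_of_mem`.
* `exists_factor_ker_of_exists_factor` — MONOTONICITY: if `c • 𝟙_N` factors through a free module and
  `π : F ↠ N` with `F` free, then `c • 𝟙_{ker π}` factors through a free module (so a non-factorisation
  that disappears after one syzygy is no evidence against `c ∈ ca`).
* `negCont`, `runRec`, `tailCont`, `runRec_eq`, `tailCont_lt`, `slope_lemma` — minus-continuants of a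
  chain of integers `≥ 2` and the ONE-SIDED CONTINUANT INEQUALITY: if the order sequence obeys
  `z_{j+1} = c_j z_j − z_{j−1}` with `1 ≤ z₀`, `z₀ + 1 ≤ z₁`, then `K⁻(c₁,…,c_b) ≤ z_{b+1}` (the abstract
  form of the toric box criterion on `Z_ca`-contracted chains; the toric dictionary — orders of `ca`
  along the Hirzebruch–Jung chain satisfy the recurrence with a strict increase — is tri-2's (G1) data
  and is NOT claimed here).
* `subset_of_valuativelyClosed_of_shallow` — THE CUT of card 2, hypotheses inlined: if `ca` of the
  normalised chart is valuatively closed and `x` has shallow witnesses along every valuation ring, then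
  (given the landed reduction `x ∈ ca C → ca B ⊆ ca C` as a hypothesis) `ca B ⊆ ca C`.

`[OURS · L1 w44b · idea-2]`; elementary module theory / integer arithmetic, not a statement of any
manuscript. AI-written; weaker than expert review.
-/

-- single-problem summit: the doubled namespace component is forced
set_option linter.dupNamespace false

namespace Summit.ResolutionOfSingularities.ResolutionOfSingularities.Theorems.HomologicalConductor.PersistenceSupply

open Literature.RingTheory.CohomologyAnnihilator

universe u v w

/-! ## The supply lemma -/

/-- **Supply lemma** (dimension-free): if `x` kills `N` and `0 → Y →ᶠ P →ᵍ N` is exact at `P` with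
`f` injective, then `x • 𝟙_Y` factors through `P`: there is `h : P → Y` with `h ∘ f = x • 𝟙_Y`
(`h p :=` the unique `y` with `f y = x • p`). With `P` projective, `x` stably annihilates every
retract of `Y = Ω N`. [folklore] -/
theorem exists_comp_eq_smul_id_of_exact {C : Type u} [CommRing C] (x : C)
    {N : Type v} {P : Type w} {Y : Type*} [AddCommGroup N] [Module C N] [AddCommGroup P]
    [Module C P] [AddCommGroup Y] [Module C Y] (hN : ∀ n : N, x • n = 0)
    (f : Y →ₗ[C] P) (g : P →ₗ[C] N) (hf : Function.Injective f) (hfg : Function.Exact f g) :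
    ∃ h : P →ₗ[C] Y, h ∘ₗ f = x • LinearMap.id := by
  have key : ∀ p : P, ∃ y : Y, f y = x • p := by
    intro p
    have h0 : g (x • p) = 0 := by rw [map_smul, hN]
    exact (hfg (x • p)).mp h0
  choose s hs using key
  have hadd : ∀ p q : P, s (p + q) = s p + s q := by
    intro p q
    apply hf
    rw [map_add, hs, hs, hs, smul_add]
  have hsmul : ∀ (c : C) (p : P), s (c • p) = c • s p := by
    intro c p
    apply hf
    rw [map_smul, hs, hs, smul_comm]
  refine ⟨{ toFun := s, map_add' := hadd, map_smul' := hsmul }, ?_⟩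
  ext y
  apply hf
  simp only [LinearMap.coe_comp, Function.comp_apply, LinearMap.coe_mk, AddHom.coe_mk,
    LinearMap.smul_apply, LinearMap.id_coe, id_eq, map_smul]
  rw [hs]

/-- Rank-one instance of the supply: an ideal `J ∋ x` is stably killed by `x` — `x • 𝟙_J` is
`J ↪ C` followed by `c ↦ c • x` (every divisorial ideal below `div x` has `x` in its trace ideal).
[folklore] -/
theorem smul_id_factors_of_mem {C : Type u} [CommRing C] (J : Ideal C) (x : C) (hx : x ∈ J) :
    ∃ (α : J →ₗ[C] C) (β : C →ₗ[C] J), β ∘ₗ α = x • LinearMap.id := by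
  refine ⟨J.subtype, LinearMap.toSpanSingleton C J ⟨x, hx⟩, ?_⟩
  ext j
  simp [LinearMap.toSpanSingleton, mul_comm]

/-! ## Monotonicity of free factorisations under syzygy -/

/-- **Free factorisations pass to first syzygies.** If `c • 𝟙_N = β ∘ α` factors through a free
module and `π : F ↠ N` is a surjection from a free module, then `c • 𝟙_{ker π}` factors through the
free module `F`: lift `β` to `β' : _ → F` (`π ∘ β' = β`); the endomorphism `c • 𝟙_F − β' ∘ α ∘ π`
of `F` takes values in `ker π` and restricts to `c • 𝟙` on `ker π`. [folklore] -/
theorem exists_factor_ker_of_exists_factor {R : Type u} [CommRing R] {c : R} {N F : Type u}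
    [AddCommGroup N] [Module R N] [AddCommGroup F] [Module R F] [Module.Free R F]
    (π : F →ₗ[R] N) (hπ : Function.Surjective π)
    (h : ∃ (ι : Type u) (α : N →ₗ[R] (ι →₀ R)) (β : (ι →₀ R) →ₗ[R] N),
      β ∘ₗ α = c • LinearMap.id) :
    ∃ (ι : Type u) (α : LinearMap.ker π →ₗ[R] (ι →₀ R)) (β : (ι →₀ R) →ₗ[R] LinearMap.ker π),
      β ∘ₗ α = c • LinearMap.id := by
  obtain ⟨ι, α, β, hβα⟩ := h
  obtain ⟨β', hβ'⟩ := Module.projective_lifting_property π β hπ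
  let φ : F →ₗ[R] F := c • LinearMap.id - β' ∘ₗ α ∘ₗ π
  have hφ : ∀ y : F, φ y ∈ LinearMap.ker π := by
    intro y
    have h1 : π (β' (α (π y))) = β (α (π y)) := by
      rw [← LinearMap.comp_apply (f := π) (g := β'), hβ']
    have h2 : β (α (π y)) = c • π y := by
      rw [← LinearMap.comp_apply (f := β) (g := α), hβα, LinearMap.smul_apply, LinearMap.id_apply]
    rw [LinearMap.mem_ker]
    simp only [φ, LinearMap.sub_apply, LinearMap.smul_apply, LinearMap.id_apply, LinearMap.coe_comp,
      Function.comp_apply, map_sub, map_smul, h1, h2, sub_self]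
  let φ' : F →ₗ[R] LinearMap.ker π := LinearMap.codRestrict (LinearMap.ker π) φ hφ
  let b := Module.Free.chooseBasis R F
  refine ⟨Module.Free.ChooseBasisIndex R F, b.repr.toLinearMap ∘ₗ (LinearMap.ker π).subtype,
    φ' ∘ₗ b.repr.symm.toLinearMap, ?_⟩
  apply LinearMap.ext
  intro x
  apply Subtype.ext
  have hx : π (x : F) = 0 := x.2
  simp only [φ', φ, LinearMap.coe_comp, Function.comp_apply, LinearEquiv.coe_toLinearMap,
    Submodule.coe_subtype, LinearEquiv.symm_apply_apply, LinearMap.codRestrict_apply,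
    LinearMap.sub_apply, LinearMap.smul_apply, LinearMap.id_apply, hx, map_zero, sub_zero,
    Submodule.coe_smul]

/-! ## Minus-continuants and the one-sided continuant inequality -/

/-- Minus-continuant `K⁻(c₁,…,c_k)` (`= d(i+1,b)` for the chain `c_{i+1},…,c_b` of negated
self-intersection numbers of a Hirzebruch–Jung chain). [folklore] -/
def negCont : List ℤ → ℤ
  | [] => 1
  | [c] => c
  | c :: d :: t => c * negCont (d :: t) - negCont t

/-- Propagate the recurrence `z_{j+1} = c_j z_j - z_{j-1}` from `(z₀, z₁)` along the chain; returns
the terminal value `z_{b+1}`. [folklore] -/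
def runRec : List ℤ → ℤ → ℤ → ℤ
  | [], _, z₁ => z₁
  | c :: t, z₀, z₁ => runRec t z₁ (c * z₁ - z₀)

/-- `tailCont cs` = minus-continuant of the tail (`0` for the empty list), so that
`runRec cs z₀ z₁ = negCont cs * z₁ - tailCont cs * z₀` (`runRec_eq`). [folklore] -/
def tailCont : List ℤ → ℤ
  | [] => 0
  | _ :: t => negCont t

/-- First-row expansion of the minus-continuant. [folklore] -/
theorem negCont_cons (c : ℤ) (t : List ℤ) : negCont (c :: t) = c * negCont t - tailCont t := by
  cases t with
  | nil => simp [negCont, tailCont]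
  | cons d t' => simp [negCont, tailCont]

/-- The recurrence is linear in the initial data with continuant coefficients. [folklore] -/
theorem runRec_eq (cs : List ℤ) :
    ∀ z₀ z₁, runRec cs z₀ z₁ = negCont cs * z₁ - tailCont cs * z₀ := by
  induction cs with
  | nil => intro z₀ z₁; simp [runRec, negCont, tailCont]
  | cons c t ih =>
    intro z₀ z₁
    rw [runRec, ih, negCont_cons]
    cases t with
    | nil => simp [negCont, tailCont]
    | cons d t' => simp [tailCont]; ring

/-- Minus-continuants of integers `≥ 2` increase strictly along the chain:
`0 ≤ tailCont cs < negCont cs`. [folklore] -/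
theorem tailCont_lt (cs : List ℤ) (hc : ∀ c ∈ cs, 2 ≤ c) :
    0 ≤ tailCont cs ∧ tailCont cs + 1 ≤ negCont cs := by
  induction cs with
  | nil => simp [tailCont, negCont]
  | cons c t ih =>
    have hc' : ∀ x ∈ t, 2 ≤ x := fun x hx => hc x (List.mem_cons_of_mem c hx)
    have h2 : 2 ≤ c := hc c (by simp)
    obtain ⟨h0, h1⟩ := ih hc'
    rw [negCont_cons]
    cases t with
    | nil =>
      simp only [tailCont, negCont]
      constructor <;> linarith
    | cons d t' =>
      simp only [tailCont] at h0 h1 ⊢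
      have hP : 0 ≤ negCont (d :: t') := by linarith
      have h2P : 2 * negCont (d :: t') ≤ c * negCont (d :: t') := mul_le_mul_of_nonneg_right h2 hP
      constructor
      · exact hP
      · linarith

/-- **Slope lemma (one-sided continuant inequality).** Along a chain `c₁,…,c_b` of integers `≥ 2`,
if an order sequence obeying `z_{j+1} = c_j z_j − z_{j−1}` starts with `1 ≤ z₀` and a STRICT increase
`z₀ + 1 ≤ z₁`, then the continuant `K⁻(c₁,…,c_b) = negCont cs` is at most the terminal order
`z_{b+1} = runRec cs z₀ z₁`. (Card 1's toric proof path: the special class `d(i+1,b)·e_b` lies in the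
box on the `e_b`-side; numerically 0 violations in 241 901 (chart, special) rows for `d ≤ 300`,
kit job j261409 — the toric dictionary itself is not formalised here.) [folklore] -/
theorem slope_lemma (cs : List ℤ) (hc : ∀ c ∈ cs, 2 ≤ c) (z₀ z₁ : ℤ) (h₀ : 1 ≤ z₀)
    (h₁ : z₀ + 1 ≤ z₁) : negCont cs ≤ runRec cs z₀ z₁ := by
  rw [runRec_eq]
  obtain ⟨hq0, hq1⟩ := tailCont_lt cs hc
  have hP : 0 ≤ negCont cs := by linarith
  have hA : negCont cs * (z₀ + 1) ≤ negCont cs * z₁ := mul_le_mul_of_nonneg_left h₁ hP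
  have hB : 0 ≤ (negCont cs - tailCont cs) * z₀ := mul_nonneg (by linarith) (by linarith)
  nlinarith [hA, hB]

/-- Sanity instance: the `A₂` chain `(2,2)` has `K⁻ = 3` and orders `1, 2 ↦ 4`. [folklore] -/
example : negCont [2, 2] = 3 ∧ runRec [2, 2] 1 2 = 4 := by decide

/-! ## The «valuatively closed + shallow witnesses» cut (card 2) -/

section Cut

variable {k K : Type} [Field k] [Field K] [Algebra k K]

/-- **The cut.** Write `ca S ⊆ K` for the image of the cohomology annihilator of a subalgebra `S`.
Let `C` be any subalgebra containing `x` (in the application: the normalised affine `ca`-chart of `B`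
at `x`). If (a) `ca C` is VALUATIVELY CLOSED — an element of `C` that is `ca C`-deep along every
valuation ring `W ⊇ C` lies in `ca C` — and (b) `x` has SHALLOW WITNESSES — along every such `W` some
nonzero element of `ca C` is at most as deep as `x` — then `x ∈ ca C`; hence, given the reduction
`x ∈ ca C → ca B ⊆ ca C` (landed H_a, supplied as a hypothesis), `ca B ⊆ ca C`. [folklore] -/
theorem subset_of_valuativelyClosed_of_shallow (B C : Subalgebra k K) (x : K) (hxC : x ∈ C)
    (hclosed : ∀ y : K, y ∈ C →
      (∀ W : ValuationSubring K, C.toSubring ≤ W.toSubring →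
        ∃ c ∈ (((↑) : ↥C → K) '' (cohomologyAnnihilator ↥C : Set ↥C)), c ≠ 0 ∧ y * c⁻¹ ∈ W) →
      y ∈ (((↑) : ↥C → K) '' (cohomologyAnnihilator ↥C : Set ↥C)))
    (hshallow : ∀ W : ValuationSubring K, C.toSubring ≤ W.toSubring →
      ∃ c ∈ (((↑) : ↥C → K) '' (cohomologyAnnihilator ↥C : Set ↥C)), c ≠ 0 ∧ x * c⁻¹ ∈ W)
    (hreduce : x ∈ (((↑) : ↥C → K) '' (cohomologyAnnihilator ↥C : Set ↥C)) →
      (((↑) : ↥B → K) '' (cohomologyAnnihilator ↥B : Set ↥B)) ⊆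
        (((↑) : ↥C → K) '' (cohomologyAnnihilator ↥C : Set ↥C))) :
    (((↑) : ↥B → K) '' (cohomologyAnnihilator ↥B : Set ↥B)) ⊆
      (((↑) : ↥C → K) '' (cohomologyAnnihilator ↥C : Set ↥C)) :=
  hreduce (hclosed x hxC hshallow)

/-- The element `x ∈ ca B` lies in the normalisation (inside `K`) of the affine chart
`B[ca B / x]`: `x ∈ B ⊆ B[ca B/x]` and elements of a subalgebra are integral over it — the membership
hypothesis `hxC` of `subset_of_valuativelyClosed_of_shallow` in the application. [folklore] -/
theorem mem_nrm_affChart_of_mem (B : Subalgebra k K) (x : K) (hxB : x ∈ B) :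
    x ∈ Algebra.adjoin k {y : K | IsIntegral
      ↥(Algebra.adjoin k ((B : Set K) ∪ {y : K | ∃ c ∈ (((↑) : ↥B → K) ''
        (cohomologyAnnihilator ↥B : Set ↥B)), y = c * x⁻¹})) y} := by
  set A := Algebra.adjoin k ((B : Set K) ∪ {y : K | ∃ c ∈ (((↑) : ↥B → K) ''
        (cohomologyAnnihilator ↥B : Set ↥B)), y = c * x⁻¹}) with hA
  have hxA : x ∈ A := Algebra.subset_adjoin (Or.inl hxB)
  have : IsIntegral ↥A x := by
    simpa using (isIntegral_algebraMap (R := ↥A) (A := K) (x := ⟨x, hxA⟩))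
  exact Algebra.subset_adjoin this

end Cut

end Summit.ResolutionOfSingularities.ResolutionOfSingularities.Theorems.HomologicalConductor.PersistenceSupply
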